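import Summits.Ventures.Crystal3D.Theorems.StickyWulffConstantTextureLiminfTentBarlowFrames
import HarnessLib

/-!
# The zigzag chart of one bilayer: an affine map of determinant `(√3/2)·D₂` onto the layer slab, and the slab volume
# as an integral over the lines (lane T, flux count F1; crux `TextureLiminf`, stmt-Ventures-19483)

HONEST FRAMING. Venture `Summits/Ventures/Crystal3D` (cell `crystal3d-full`), helper `--supports` the crux
`TextureLiminf` (stmt-Ventures-19483) of `route-Ventures-StickyWulffConstant`, registered line `TexShadow` (v6.6; cf-p1
ROUTE.md §86(26) U / §86(42) AK: the FLUX COUNT of the per-top walker families on a clamped Barlow plate, owner wulff-p2).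
Rung credit only; F-C1 not moved.  Pure affine geometry / measure theory in MODEL coordinates of a stacking.

The zigzag lines of a plate are the translates `Γ + t`, `t ∈ ℤu + ℤv`, of one model polyline `Γ` (vertex `Γ k` in layer
`k`, step `D k = Γ (k+1) − Γ k` an inter-layer bond).  The ZIGZAG CHART of bilayer `k` is the affine map
`y ↦ y₀ u + y₁ v + y₂ D + Γ k` (`u = (1,0,0)`, `v = (½, √3/2, 0)` the in-layer basis): it maps `{0 < y₂ < 1}` onto the open
slab between the layer planes of `Γ k` and `Γ k + D`, and its determinant is `(√3/2)·D₂` WHATEVER the lateral part of the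
step — so the zigzag foliation of space is volume-preserving up to the constant `(√3/2)·√(2/3) = 1/√2`, uniformly in the
word and the orientation.  Consequently the volume a set `S` has inside one layer slab is `(√3/2)·D₂` times the measure of
its chart preimage, i.e. an integral over the lines `x ∈ ℝ²` of the parameter length each line spends in `S`:

* `zigLin D`, `zigLin_apply_coord`, `det_zigLin` (`= (√3/2)·D₂`); `zigChart Γk D`, `zigChart_apply_two`;
* `volume_inter_laySlab_eq_zigChart` — `|S ∩ slab| = (√3/2)D₂ · |{y : zigChart y ∈ S, 0 < y₂ < 1}|`;
* `volume_inter_laySlab_eq_lintegral_zigChart` — the same as `(√3/2)D₂ · ∫⁻ x : ℝ², |{τ ∈ (0,1) : x₀u + x₁v + Γk + τD ∈ S}|`.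
WHAT THIS IS NOT: not the flux count yet (no lattice sum, no plate); F-C1 not moved.
-/

noncomputable section

namespace Summit.Ventures.Crystal3D.Theorems

open MeasureTheory
open scoped ENNReal
open Literature.MathematicalPhysics.StatisticalMechanics (triangularVec₁ triangularVec₂)
open Summit.Ventures.Crystal3D.Cruxes.TextureLiminf.TexShadow (E3)

/-! ## The linear part and its determinant -/

/-- The linear part of the zigzag chart: `y ↦ y₀ u + y₁ v + y₂ D`. -/
def zigLin (D : E3) : E3 →ₗ[ℝ] E3 :=
  (EuclideanSpace.proj (0 : Fin 3)).toLinearMap.smulRight (triangularVec₁ 1) +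
    (EuclideanSpace.proj (1 : Fin 3)).toLinearMap.smulRight (triangularVec₂ 1) +
    (EuclideanSpace.proj (2 : Fin 3)).toLinearMap.smulRight D

/-- The linear part, unfolded. -/
theorem zigLin_apply (D y : E3) :
    zigLin D y = (y 0) • triangularVec₁ 1 + (y 1) • triangularVec₂ 1 + (y 2) • D := by
  simp [zigLin, LinearMap.smulRight_apply]

/-- Coordinates of the linear part: `u = (1,0,0)`, `v = (½, √3/2, 0)`. -/
theorem zigLin_apply_coord (D y : E3) :
    zigLin D y 0 = y 0 + y 1 / 2 + y 2 * D 0 ∧ zigLin D y 1 = y 1 * (Real.sqrt 3 / 2) + y 2 * D 1 ∧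
      zigLin D y 2 = y 2 * D 2 := by
  rw [zigLin_apply]
  refine ⟨?_, ?_, ?_⟩
  · simp [triangularVec₁, triangularVec₂]; ring
  · simp [triangularVec₁, triangularVec₂]
  · simp [triangularVec₁, triangularVec₂]

/-- **The determinant of the zigzag chart is `(√3/2)·D₂`.** -/
theorem det_zigLin (D : E3) : LinearMap.det (zigLin D) = Real.sqrt 3 / 2 * D 2 := by
  classical
  rw [← LinearMap.det_toMatrix (EuclideanSpace.basisFun (Fin 3) ℝ).toBasis, Matrix.det_fin_three]
  have hentry : ∀ i j : Fin 3, LinearMap.toMatrix (EuclideanSpace.basisFun (Fin 3) ℝ).toBasis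
      (EuclideanSpace.basisFun (Fin 3) ℝ).toBasis (zigLin D) i j = zigLin D (EuclideanSpace.single j 1) i := by
    intro i j
    rw [LinearMap.toMatrix_apply, OrthonormalBasis.coe_toBasis_repr_apply, EuclideanSpace.basisFun_repr,
      OrthonormalBasis.coe_toBasis, EuclideanSpace.basisFun_apply]
  simp only [hentry]
  have h0 := zigLin_apply_coord D (EuclideanSpace.single 0 1)
  have h1 := zigLin_apply_coord D (EuclideanSpace.single 1 1)
  have h2 := zigLin_apply_coord D (EuclideanSpace.single 2 1)
  simp only [PiLp.single_apply] at h0 h1 h2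
  simp only [Fin.isValue, ↓reduceIte, one_ne_zero, zero_ne_one, Fin.reduceEq] at h0 h1 h2
  rw [h0.1, h0.2.1, h0.2.2, h1.1, h1.2.1, h1.2.2, h2.1, h2.2.1, h2.2.2]
  ring

/-! ## The chart and the slab -/

/-- The zigzag chart of the bilayer with base vertex `Γk` and step `D`: `y ↦ y₀ u + y₁ v + y₂ D + Γk`. -/
def zigChart (Γk D : E3) (y : E3) : E3 := zigLin D y + Γk

/-- The height of the chart: `(zigChart y)₂ = Γk₂ + y₂·D₂`. -/
theorem zigChart_apply_two (Γk D y : E3) : zigChart Γk D y 2 = Γk 2 + y 2 * D 2 := by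
  rw [zigChart, PiLp.add_apply, (zigLin_apply_coord D y).2.2]; ring

/-- The chart is continuous. -/
theorem continuous_zigChart (Γk D : E3) : Continuous (zigChart Γk D) :=
  ((zigLin D).continuous_of_finiteDimensional).add continuous_const

/-- **The volume of a set inside one layer slab, through the chart.**  For `D₂ > 0` and measurable `S`:
`|S ∩ {Γk₂ < w₂ < Γk₂ + D₂}| = (√3/2)·D₂ · |{y : zigChart Γk D y ∈ S, 0 < y₂ < 1}|`. -/
theorem volume_inter_laySlab_eq_zigChart (Γk D : E3) (hD : 0 < D 2) (S : Set E3) :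
    volume (S ∩ {w : E3 | Γk 2 < w 2 ∧ w 2 < Γk 2 + D 2}) =
      ENNReal.ofReal (Real.sqrt 3 / 2 * D 2) * volume {y : E3 | zigChart Γk D y ∈ S ∧ 0 < y 2 ∧ y 2 < 1} := by
  have h3 : 0 < Real.sqrt 3 / 2 := by positivity
  have hdet : LinearMap.det (zigLin D) = Real.sqrt 3 / 2 * D 2 := det_zigLin D
  have hdet0 : LinearMap.det (zigLin D) ≠ 0 := by rw [hdet]; positivity
  -- the chart preimage of `S ∩ slab` is `{zigChart ∈ S} ∩ {0 < y₂ < 1}`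
  have hpre : {y : E3 | zigChart Γk D y ∈ S ∧ 0 < y 2 ∧ y 2 < 1} =
      (zigLin D) ⁻¹' ((fun w => w + Γk) ⁻¹' (S ∩ {w : E3 | Γk 2 < w 2 ∧ w 2 < Γk 2 + D 2})) := by
    ext y
    simp only [Set.mem_setOf_eq, Set.mem_preimage, Set.mem_inter_iff]
    rw [show zigLin D y + Γk = zigChart Γk D y from rfl, zigChart_apply_two]
    constructor
    · rintro ⟨hS', h0, h1⟩; exact ⟨hS', by nlinarith, by nlinarith⟩
    · rintro ⟨hS', h0, h1⟩
      refine ⟨hS', ?_, ?_⟩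
      · nlinarith
      · nlinarith
  rw [hpre, MeasureTheory.Measure.addHaar_preimage_linearMap _ hdet0, measure_preimage_add_right, hdet,
    ← mul_assoc, ← ENNReal.ofReal_mul (by positivity), abs_of_pos (by positivity),
    mul_inv_cancel₀ (by positivity), ENNReal.ofReal_one, one_mul]

/-! ## The slab volume as an integral over the lines -/

/-- The chart in split coordinates `(τ, x) ∈ ℝ × ℝ²`: `x₀ u + x₁ v + τ D + Γk`. -/
def zigChart' (Γk D : E3) (p : ℝ × (Fin 2 → ℝ)) : E3 :=
  (p.2 0) • triangularVec₁ 1 + (p.2 1) • triangularVec₂ 1 + p.1 • D + Γk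

/-- The chart is continuous in split coordinates. -/
theorem continuous_zigChart' (Γk D : E3) : Continuous (zigChart' Γk D) := by
  unfold zigChart'
  fun_prop

/-- Split coordinates: `zigChart` is `zigChart'` after `y ↦ (y₂, (y₀, y₁))`. -/
theorem zigChart_eq_zigChart' (Γk D y : E3) :
    zigChart Γk D y = zigChart' Γk D ((MeasurableEquiv.piFinSuccAbove (fun _ : Fin 3 => ℝ) 2) (WithLp.ofLp y)) := by
  rw [zigChart, zigLin_apply, zigChart']
  simp [MeasurableEquiv.piFinSuccAbove, Fin.removeNth, Fin.succAbove]

/-- **The volume of a set inside one layer slab is an integral over the lines.**  For `D₂ > 0` and measurable `S`: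
`|S ∩ {Γk₂ < w₂ < Γk₂ + D₂}| = (√3/2)·D₂ · ∫⁻ x : ℝ², |{τ ∈ (0,1) : zigChart' Γk D (τ, x) ∈ S}|`. -/
theorem volume_inter_laySlab_eq_lintegral_zigChart (Γk D : E3) (hD : 0 < D 2) (S : Set E3) (hS : MeasurableSet S) :
    volume (S ∩ {w : E3 | Γk 2 < w 2 ∧ w 2 < Γk 2 + D 2}) =
      ENNReal.ofReal (Real.sqrt 3 / 2 * D 2) *
        ∫⁻ x : Fin 2 → ℝ, volume {τ : ℝ | zigChart' Γk D (τ, x) ∈ S ∧ 0 < τ ∧ τ < 1} := by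
  rw [volume_inter_laySlab_eq_zigChart Γk D hD S]
  congr 1
  set A' : Set (ℝ × (Fin 2 → ℝ)) := {p | zigChart' Γk D p ∈ S ∧ 0 < p.1 ∧ p.1 < 1} with hA'
  have hA'meas : MeasurableSet A' := by
    have h1 : MeasurableSet (zigChart' Γk D ⁻¹' S) := (continuous_zigChart' Γk D).measurable hS
    have h2 : MeasurableSet {p : ℝ × (Fin 2 → ℝ) | 0 < p.1} := measurableSet_lt measurable_const measurable_fst
    have h3 : MeasurableSet {p : ℝ × (Fin 2 → ℝ) | p.1 < 1} := measurableSet_lt measurable_fst measurable_const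
    have : A' = (zigChart' Γk D ⁻¹' S) ∩ {p | 0 < p.1} ∩ {p | p.1 < 1} := by
      ext p; simp [hA', and_assoc]
    rw [this]; exact (h1.inter h2).inter h3
  have hset : {y : E3 | zigChart Γk D y ∈ S ∧ 0 < y 2 ∧ y 2 < 1} =
      (WithLp.ofLp : E3 → (Fin 3 → ℝ)) ⁻¹' ((MeasurableEquiv.piFinSuccAbove (fun _ : Fin 3 => ℝ) 2) ⁻¹' A') := by
    ext y
    simp only [Set.mem_setOf_eq, Set.mem_preimage, hA']
    rw [zigChart_eq_zigChart']
    simp [MeasurableEquiv.piFinSuccAbove]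
  rw [hset, (PiLp.volume_preserving_ofLp (Fin 3)).measure_preimage
      (((MeasurableEquiv.piFinSuccAbove (fun _ : Fin 3 => ℝ) 2).measurable hA'meas).nullMeasurableSet),
    (volume_preserving_piFinSuccAbove (fun _ : Fin 3 => ℝ) 2).measure_preimage hA'meas.nullMeasurableSet,
    show (volume : Measure (ℝ × (Fin 2 → ℝ))) = volume.prod volume from rfl, Measure.prod_apply_symm hA'meas]
  rfl

end Summit.Ventures.Crystal3D.Theorems

end
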